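import Literature.AlgebraicGeometry.HodgeTheory.LimitMixedHodgeStructureRelativeHom
import Literature.AlgebraicGeometry.Motives.MixedHodgeStructureInternalHomUnit
import HarnessLib

/-!
# Tate twists of `L₁ ⊗ L₂` and `Hom(L₁, L₂)`, and `Hom(L, ℚ(0)) = L^∨`, for relative limit mixed Hodge structures

Topic `Literature/AlgebraicGeometry/HodgeTheory` (namespace `Literature.AlgebraicGeometry.HodgeTheory`). A sequel to
`LimitMixedHodgeStructureRelativeTensor.lean` (`L₁ ⊗ L₂`), `LimitMixedHodgeStructureRelativeHom.lean` (`Hom(L₁, L₂)`,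
the transport `comapEquiv`), `LimitMixedHodgeStructureRelativeDual.lean` (`L^∨`, `dual_tateTwist`) and
`LimitMixedHodgeStructureRelativeTateTwist.lean` (`L(j)`: `W_{•+2j}`, `F^{•+j}`, `W^f_{•+2j}`, same `N`) for the
tree's `RelativeLimitMixedHodgeStructure V` (Cattani–El Zein–Griffiths–Lê, Remark 8.2.2; Kashiwara's IMHM for one `N`),
lifting the tree's MHS identities `MixedHodgeStructure.tensor_tateTwist_left ∕ _right`, `comapEquiv_tateTwist`,
`hom_tateTwist_right ∕ _left` and `hom_unit_eq_dual` through `W^f` and `N`. Theorems only (no definition, no named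
fact, no instance; D-0026 net debt `0`).

PRINTED SOURCES, VERBATIM.
* M. Kashiwara, *A study of variation of mixed Hodge structure*, Publ. RIMS 22 (1986), §4.3 (held text p0017, p.
  1007): the tensor product and «inner-Hom … of IMHM's are also IMHM's»; §5.8 (p. 1021): the Tate-twisted objects
  `H(0)`, `Hom(H(0), H′)`.
* E. Cattani et al. (eds.), *Hodge Theory* (Math. Notes 49), Ex. 3.2.23 (4) (p. 163): the Tate twist `H(j)`,
  `W_k H(j) = W_{k+2j}`, `F^p H(j) = F^{p+j}`; §3.2.2.7 (1) (p0163): `Hom(H₁, H₂) = H₁^∨ ⊗ H₂`, «In particular, the dual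
  `H^*` … is an MHS»; §8.3.2.4 (p0361): the structures Hom and tensor product on mixed nilpotent orbits ∕ IMHS;
  Remark 8.2.2 (p0338).
* P. Deligne, *Théorie de Hodge II*, 1.1.6, 1.1.12, 2.1.13–2.1.14: `Hom`, `⊗`, duals and shifts of filtered objects,
  `H(j) = H ⊗ ℚ(j)`; P. Deligne, J. Milne, *Tannakian categories*, §1 (1.6.4)–(1.7): `X^∨ = Hom(X, 𝟙)`.

THIS FILE (all proved; `V`, `V′` finite-dimensional over `ℚ`).
* §1 `tensor_tateTwist_left ∕ _right`: `L₁(j) ⊗ L₂ = (L₁ ⊗ L₂)(j) = L₁ ⊗ L₂(j)` (`Σ_{i+k=n} W^f₁_{i+2j} ⊗ W^f₂_k =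
  W^f_{n+2j}(L₁ ⊗ L₂)`; same `N`).
* §2 `comapEquiv_tateTwist`: transport commutes with twisting.
* §3 `hom_tateTwist_right ∕ _left`: `Hom(L₁, L₂(j)) = Hom(L₁, L₂)(j)`, `Hom(L₁(j), L₂) = Hom(L₁, L₂)(−j)`.
* §4 **`hom_unit_eq_dual`: `Hom(L, ℚ(0)) = L^∨`** — the inner Hom into the unit (the MHS `ℚ(0)` with `N = 0`,
  `W^f = W`) IS the dual relative limit MHS of `LimitMixedHodgeStructureRelativeDual.lean`: `Hom(W^f, W(ℚ(0)))_r =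
  (W^f_{−1−r})^⊥` and `0 ∘ f − f ∘ N = −ᵗN f`.

## References

* [Kashiwara1986] M. Kashiwara, *A study of variation of mixed Hodge structure*, Publ. RIMS Kyoto Univ. 22 (1986)
  991–1024: §4.3 (p. 1007; held text p0017), §5.8 (p. 1021; p0031).
* [CattaniElZeinGriffithsLe2014] E. Cattani et al. (eds.), *Hodge Theory*, Math. Notes 49, Princeton UP (2014):
  Ex. 3.2.23 (4) and §3.2.2.7 (p. 163), §8.3.2.4 (p0361), Remark 8.2.2 (p0338).
* [DeligneHodgeII1971] P. Deligne, *Théorie de Hodge II*, Publ. Math. IHÉS 40 (1971): 1.1.6, 1.1.12, 2.1.14.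
* [DeligneMilne1982Tannakian] P. Deligne, J. S. Milne, *Tannakian categories*, in LNM 900 (1982): §1 (1.6.4)–(1.7).
-/

noncomputable section

open scoped TensorProduct

namespace Literature.AlgebraicGeometry.HodgeTheory

open Motives

universe u v

namespace RelativeLimitMixedHodgeStructure

/-! ## §1 Tate twists of the tensor product -/

section Tensor

variable {V : Type u} [AddCommGroup V] [Module ℚ V] [FiniteDimensional ℚ V]
variable {V' : Type v} [AddCommGroup V'] [Module ℚ V'] [FiniteDimensional ℚ V']

/-- **`L₁(j) ⊗ L₂ = (L₁ ⊗ L₂)(j)`** as relative limit mixed Hodge structures on `V ⊗ V′` (the tree's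
`MixedHodgeStructure.tensor_tateTwist_left` on `(W, F)`; `Σ_{i+k=n} W^f₁_{i+2j} ⊗ W^f₂_k = W^f_{n+2j}(L₁ ⊗ L₂)`;
the same `N₁ ⊗ 1 + 1 ⊗ N₂`). [cite: DeligneHodgeII1971, 1.1.12 and 2.1.14] [cite: Kashiwara1986, §4.3 (p. 1007)] -/
theorem tensor_tateTwist_left (L₁ : RelativeLimitMixedHodgeStructure V) (L₂ : RelativeLimitMixedHodgeStructure V')
    (j : ℤ) : (L₁.tateTwist j).tensor L₂ = (L₁.tensor L₂).tateTwist j := by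
  refine ext_of (MixedHodgeStructure.tensor_tateTwist_left L₁.toMixedHodgeStructure L₂.toMixedHodgeStructure j)
    (funext fun n => ?_) rfl
  rw [tateTwist_wf, tensor_wf, tensor_wf]
  simp only [tateTwist_wf]
  apply le_antisymm
  · refine iSup₂_le fun ik (hik : ik.1 + ik.2 = n) => ?_
    exact le_biSup (fun ij : ℤ × ℤ => Submodule.map₂ (TensorProduct.mk ℚ V V') (L₁.wf ij.1) (L₂.wf ij.2))
      (i := (ik.1 + 2 * j, ik.2)) (show ik.1 + 2 * j + ik.2 = n + 2 * j by omega)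
  · refine iSup₂_le fun ij (hij : ij.1 + ij.2 = n + 2 * j) => ?_
    have h : L₁.wf ij.1 = L₁.wf (ij.1 - 2 * j + 2 * j) := by rw [sub_add_cancel]
    rw [h]
    exact le_biSup (fun ik : ℤ × ℤ =>
        Submodule.map₂ (TensorProduct.mk ℚ V V') (L₁.wf (ik.1 + 2 * j)) (L₂.wf ik.2))
      (i := (ij.1 - 2 * j, ij.2)) (show ij.1 - 2 * j + ij.2 = n by omega)

/-- **`L₁ ⊗ L₂(j) = (L₁ ⊗ L₂)(j)`** as relative limit mixed Hodge structures on `V ⊗ V′`.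
[cite: DeligneHodgeII1971, 1.1.12 and 2.1.14] [cite: Kashiwara1986, §4.3 (p. 1007)] -/
theorem tensor_tateTwist_right (L₁ : RelativeLimitMixedHodgeStructure V) (L₂ : RelativeLimitMixedHodgeStructure V')
    (j : ℤ) : L₁.tensor (L₂.tateTwist j) = (L₁.tensor L₂).tateTwist j := by
  refine ext_of (MixedHodgeStructure.tensor_tateTwist_right L₁.toMixedHodgeStructure L₂.toMixedHodgeStructure j)
    (funext fun n => ?_) rfl
  rw [tateTwist_wf, tensor_wf, tensor_wf]
  simp only [tateTwist_wf]
  apply le_antisymm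
  · refine iSup₂_le fun ik (hik : ik.1 + ik.2 = n) => ?_
    exact le_biSup (fun ij : ℤ × ℤ => Submodule.map₂ (TensorProduct.mk ℚ V V') (L₁.wf ij.1) (L₂.wf ij.2))
      (i := (ik.1, ik.2 + 2 * j)) (show ik.1 + (ik.2 + 2 * j) = n + 2 * j by omega)
  · refine iSup₂_le fun ij (hij : ij.1 + ij.2 = n + 2 * j) => ?_
    have h : L₂.wf ij.2 = L₂.wf (ij.2 - 2 * j + 2 * j) := by rw [sub_add_cancel]
    rw [h]
    exact le_biSup (fun ik : ℤ × ℤ =>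
        Submodule.map₂ (TensorProduct.mk ℚ V V') (L₁.wf ik.1) (L₂.wf (ik.2 + 2 * j)))
      (i := (ij.1, ij.2 - 2 * j)) (show ij.1 + (ij.2 - 2 * j) = n by omega)

end Tensor

/-! ## §2 Tate twists and transport -/

section Transport

variable {V : Type u} [AddCommGroup V] [Module ℚ V]
variable {V' : Type v} [AddCommGroup V'] [Module ℚ V']

/-- **`e^*(L(j)) = (e^*L)(j)`**: transport along a linear isomorphism commutes with the Tate twist (the tree's
`MixedHodgeStructure.comapEquiv_tateTwist` on `(W, F)`; `e⁻¹W^f_{k+2j}` on both sides; the same `e⁻¹Ne`).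
[cite: CattaniElZeinGriffithsLe2014, Def. 3.2.15 and Ex. 3.2.23 (4)] -/
theorem comapEquiv_tateTwist (L : RelativeLimitMixedHodgeStructure V') (e : V ≃ₗ[ℚ] V') (j : ℤ) :
    (L.tateTwist j).comapEquiv e = (L.comapEquiv e).tateTwist j :=
  ext_of (MixedHodgeStructure.comapEquiv_tateTwist L.toMixedHodgeStructure e j) (funext fun _ => rfl) rfl

end Transport

/-! ## §3 Tate twists of the inner Hom -/

section Hom

variable {V : Type u} [AddCommGroup V] [Module ℚ V] [FiniteDimensional ℚ V]
variable {V' : Type v} [AddCommGroup V'] [Module ℚ V'] [FiniteDimensional ℚ V']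

/-- **`Hom(L₁, L₂(j)) = Hom(L₁, L₂)(j)`** as relative limit mixed Hodge structures on `V →ₗ[ℚ] V′`
(`L₁^∨ ⊗ L₂(j) = (L₁^∨ ⊗ L₂)(j)` transported). [cite: CattaniElZeinGriffithsLe2014, §3.2.2.7 and Ex. 3.2.23 (4)]
[cite: Kashiwara1986, §4.3 (p. 1007) and §5.8 (p. 1021)] -/
theorem hom_tateTwist_right (L₁ : RelativeLimitMixedHodgeStructure V) (L₂ : RelativeLimitMixedHodgeStructure V')
    (j : ℤ) : L₁.hom (L₂.tateTwist j) = (L₁.hom L₂).tateTwist j := by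
  unfold hom
  rw [tensor_tateTwist_right, comapEquiv_tateTwist]

/-- **`Hom(L₁(j), L₂) = Hom(L₁, L₂)(−j)`** as relative limit mixed Hodge structures on `V →ₗ[ℚ] V′`
(`(L₁(j))^∨ = L₁^∨(−j)`, `dual_tateTwist`). [cite: CattaniElZeinGriffithsLe2014, §3.2.2.7 and Ex. 3.2.23 (4)]
[cite: Kashiwara1986, §4.3 (p. 1007) and §5.8 (p. 1021)] -/
theorem hom_tateTwist_left (L₁ : RelativeLimitMixedHodgeStructure V) (L₂ : RelativeLimitMixedHodgeStructure V')
    (j : ℤ) : (L₁.tateTwist j).hom L₂ = (L₁.hom L₂).tateTwist (-j) := by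
  unfold hom
  rw [dual_tateTwist, tensor_tateTwist_left, comapEquiv_tateTwist]

/-- `Hom(L₁(j), L₂(j)) = Hom(L₁, L₂)`: simultaneous twists cancel. [cite: CattaniElZeinGriffithsLe2014, §3.2.2.7 and Ex. 3.2.23 (4)] -/
theorem hom_tateTwist_tateTwist (L₁ : RelativeLimitMixedHodgeStructure V) (L₂ : RelativeLimitMixedHodgeStructure V')
    (j : ℤ) : (L₁.tateTwist j).hom (L₂.tateTwist j) = L₁.hom L₂ := by
  rw [hom_tateTwist_right, hom_tateTwist_left, tateTwist_tateTwist, neg_add_cancel, tateTwist_zero]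

end Hom

/-! ## §4 `Hom(L, ℚ(0)) = L^∨` -/

section Unit

variable {V : Type u} [AddCommGroup V] [Module ℚ V] [FiniteDimensional ℚ V]

/-- **`Hom(L, ℚ(0)) = L^∨`**: the inner Hom into the unit relative limit MHS `ℚ(0)` (the Tate structure `ℚ(0)` with
`N = 0` and `W^f = W`, `MixedHodgeStructure.toRelativeLimitMixedHodgeStructure`) is the dual relative limit MHS —
an EQUALITY on `V →ₗ[ℚ] ℚ = Module.Dual ℚ V`: on `(W, F)` the tree's `MixedHodgeStructure.hom_unit_eq_dual`; for the
finite weight filtrations `Hom(W^f, W(ℚ(0)))_r = {f | f(W^f_k) = 0 for k + r < 0} = (W^f_{−1−r})^⊥ = W^f_r(L^∨)`; for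
the endomorphisms `0 ∘ f − f ∘ N = −ᵗN f` (Deligne–Milne (1.6.4)–(1.7): `X^∨ = Hom(X, 𝟙)`).
[cite: DeligneMilne1982Tannakian, §1 (1.6.4)–(1.7)] [cite: CattaniElZeinGriffithsLe2014, §3.2.2.7 (p. 163) and Remark 8.2.2]
[cite: DeligneHodgeII1971, 1.1.6 and 1.1.12] -/
theorem hom_unit_eq_dual (L : RelativeLimitMixedHodgeStructure V) :
    L.hom (HodgeStructure.tate 0).toMixedHodgeStructure.toRelativeLimitMixedHodgeStructure = L.dual := by
  refine ext_of (MixedHodgeStructure.hom_unit_eq_dual L.toMixedHodgeStructure)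
    (funext fun r => Submodule.ext fun f => ?_) (LinearMap.ext fun f => ?_)
  · rw [mem_hom_wf_iff, dual_wf, Submodule.mem_dualAnnihilator]
    simp only [MixedHodgeStructure.toRelativeLimitMixedHodgeStructure_wf, HodgeStructure.toMixedHodgeStructure_W]
    constructor
    · intro h w hw
      have h1 := h (-1 - r) w hw
      rwa [HodgeStructure.trivialWeightFiltration_of_lt (show -1 - r + r < -2 * 0 by omega), Submodule.mem_bot] at h1
    · intro h k x hx
      by_cases hk : k + r < -2 * 0
      · rw [HodgeStructure.trivialWeightFiltration_of_lt hk, Submodule.mem_bot]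
        exact h x (L.monotone_wf (show k ≤ -1 - r by omega) hx)
      · rw [HodgeStructure.trivialWeightFiltration_of_le (not_lt.1 hk)]
        exact Submodule.mem_top
  · rw [hom_N_apply, dual_N, MixedHodgeStructure.toRelativeLimitMixedHodgeStructure_N, LinearMap.zero_comp,
      zero_sub, LinearMap.neg_apply, LinearMap.dualMap_apply']

/-- `W^f_r Hom(L, ℚ(0)) = (W^f_{−1−r})^⊥`. [cite: CattaniElZeinGriffithsLe2014, §3.2.2.7 (p. 163) and Remark 8.2.2] -/
theorem hom_unit_wf (L : RelativeLimitMixedHodgeStructure V) (r : ℤ) :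
    (L.hom (HodgeStructure.tate 0).toMixedHodgeStructure.toRelativeLimitMixedHodgeStructure).wf r =
      (L.wf (-1 - r)).dualAnnihilator := by
  rw [hom_unit_eq_dual, dual_wf]

/-- `N_{Hom(L, ℚ(0))} = −ᵗN`. [cite: DeligneMilne1982Tannakian, §1 (1.6.4)–(1.7)] [cite: CattaniElZeinGriffithsLe2014, Remark 8.2.2] -/
theorem hom_unit_N (L : RelativeLimitMixedHodgeStructure V) :
    (L.hom (HodgeStructure.tate 0).toMixedHodgeStructure.toRelativeLimitMixedHodgeStructure).N = -L.N.dualMap := by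
  rw [hom_unit_eq_dual, dual_N]

end Unit

end RelativeLimitMixedHodgeStructure

end Literature.AlgebraicGeometry.HodgeTheory
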